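import Summits.Ventures.HSemireg.WedgeHankelKernelColumnSpace

/-!
# Venture HSemireg — THE COLUMN SPACES OF ONE CLASS ACROSS THE DEGREES: **`col H_k(q) = π_top(col H_{k+1}(q)) + π_bot(col H_{k+1}(q))`** (`k + 1 ≤ N`; `π_top`, `π_bot : K^{k+2} → K^{k+1}`
# forget the last / the first coordinate) — the columns of `H_k(q)` are the truncated columns of `H_{k+1}(q)`; hence **`col H_{k+1}(q) ⊆ col H_{k+1}(q′) ⇒ col H_k(q) ⊆ col H_k(q′)`** and,
# down the degrees, `col H_k(q) ⊆ col H_k(q′) ⇒ col H_{k′}(q) ⊆ col H_{k′}(q′)` for every `k′ ≤ k ≤ N` (the matrix mechanism behind N8: with M14, column-space control in ONE degree yields kernel control in all lower degrees)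

HONEST FRAMING. Part of the Lean index of the computation cell `pub-hsemireg` (seat p10 gen 25, Sunday typer «UNIFORM-IN-n»).
LINEAR ALGEBRA OF HANKEL (catalecticant) MATRICES over a field ONLY (plus M14's dictionary to kernels): no variety, no cohomology theory, no sheaf, no Ext group, no semiregularity map;
nothing here says that HC / HC_CM / HC_AV holds; no Literature fact is declared or used.  Custodian versions as in `WedgeHankelSiegelIdeal` (1/3); the dictionary (`H_k(q) = (q_{i+s})`,
`col H_k(q) ⊆ K^{k+1}`) is QUOTED, never asserted.

WHAT IS IN THE TREE.  th-7's `hankel1`; M14 (`WedgeHankelKernelColumnSpace`) `Kr_w_anti_of_range_hankel1_le` (`col H_k(q) ⊆ col H_k(q′) ⇒ Kr(w_N q′, k) ⊆ Kr(w_N q, k)`); Mathlib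
`Matrix.range_mulVecLin`, `LinearMap.funLeft`.
THIS FILE (namespace `Summit.Ventures.HSemireg.Wedge.HankelOuter` continued; imports M14):
* §450 `funLeft_castSucc_hankel1_succ_col` / `funLeft_succ_hankel1_succ_col` (truncating a column of `H_{k+1}` gives a column of `H_k`), **`range_hankel1_eq_map_sup_map`**
  (`col H_k(q) = π_top(col H_{k+1}(q)) ⊔ π_bot(col H_{k+1}(q))`, `k + 1 ≤ N`), **`range_hankel1_mono_of_succ`** (`col H_{k+1}(q) ⊆ col H_{k+1}(q′) ⇒ col H_k(q) ⊆ col H_k(q′)`),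
  `range_hankel1_eq_of_succ`, **`range_hankel1_mono_of_le`** (`k′ ≤ k ≤ N`: down all the degrees), `range_hankel1_eq_of_le`.
READING: with M14 (`Kr_w_anti_of_range_hankel1_le` in degree `k′`) this is the matrix route to N8's `Kr_w_anti_of_range_hankel1_le_of_le` (column-space control in degree `k` ⇒ kernel
control in every degree `k′ ≤ k`; not restated here); the matrix mechanism behind «the degree-`k` kernel determines the lower kernels» (N8 by the exterior-algebra route; N5: kernel ⟷ column space): one catalecticant's column space
determines all the lower ones by truncation.  NOT typed here: the reverse direction (`col H_k` does NOT determine `col H_{k+1}` in general), rank recursions.  Nothing Ext-side.  New names only.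
-/

open Module

namespace Summit.Ventures.HSemireg.Wedge.HankelOuter

open Summit.Ventures.HSemireg.Wedge Summit.Ventures.HSemireg.Wedge.Kunneth Summit.Ventures.HSemireg.Wedge.Hankel
  Summit.Ventures.HSemireg.Wedge.BasisFree Summit.Ventures.HSemireg.Wedge.HankelSiegel Summit.Ventures.HSemireg.Wedge.HankelSiegelIdeal
  Summit.Ventures.HSemireg.Wedge.KunnethKernel Summit.Ventures.HSemireg.Wedge.HankelFrameChange Summit.Ventures.HSemireg.Wedge.KernelDuality

variable (K : Type*) [Field K] {N : ℕ}

/-! ## §450. Truncating the columns of `H_{k+1}(q)` gives the columns of `H_k(q)` -/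

/-- forgetting the LAST coordinate of the column `s′` of `H_{k+1}(q)` gives the column `s′` of `H_k(q)`. -/
theorem funLeft_castSucc_hankel1_succ_col (k : ℕ) (q : ℕ → K) (s' : Fin (N + 1 - (k + 1))) :
    LinearMap.funLeft K K (Fin.castSucc : Fin (k + 1) → Fin (k + 1 + 1)) ((hankel1 K N (k + 1) q).col s')
      = (hankel1 K N k q).col ⟨(s' : ℕ), by omega⟩ := by
  funext i
  rw [LinearMap.funLeft_apply, Matrix.col_apply, Matrix.col_apply]
  simp only [hankel1, Matrix.of_apply, Fin.val_castSucc]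

/-- forgetting the FIRST coordinate of the column `s′` of `H_{k+1}(q)` gives the column `s′ + 1` of `H_k(q)`. -/
theorem funLeft_succ_hankel1_succ_col (k : ℕ) (q : ℕ → K) (s' : Fin (N + 1 - (k + 1))) :
    LinearMap.funLeft K K (Fin.succ : Fin (k + 1) → Fin (k + 1 + 1)) ((hankel1 K N (k + 1) q).col s')
      = (hankel1 K N k q).col ⟨(s' : ℕ) + 1, by omega⟩ := by
  funext i
  rw [LinearMap.funLeft_apply, Matrix.col_apply, Matrix.col_apply]
  simp only [hankel1, Matrix.of_apply, Fin.val_succ]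
  congr 1
  omega

/-- **THE COLUMN SPACE RECURSION: `col H_k(q) = π_top(col H_{k+1}(q)) ⊔ π_bot(col H_{k+1}(q))`** for `k + 1 ≤ N` (`π_top = funLeft castSucc` forgets the last coordinate,
`π_bot = funLeft succ` the first): every column of `H_k` is a truncated column of `H_{k+1}` (the last one from the bottom, the others from the top), and conversely. -/
theorem range_hankel1_eq_map_sup_map {k : ℕ} (hk : k + 1 ≤ N) (q : ℕ → K) :
    LinearMap.range (hankel1 K N k q).mulVecLin
      = (LinearMap.range (hankel1 K N (k + 1) q).mulVecLin).map (LinearMap.funLeft K K (Fin.castSucc : Fin (k + 1) → Fin (k + 1 + 1)))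
        ⊔ (LinearMap.range (hankel1 K N (k + 1) q).mulVecLin).map (LinearMap.funLeft K K (Fin.succ : Fin (k + 1) → Fin (k + 1 + 1))) := by
  refine le_antisymm ?_ (sup_le ?_ ?_)
  · rw [Matrix.range_mulVecLin, Submodule.span_le]
    rintro _ ⟨s, rfl⟩
    by_cases hs : (s : ℕ) < N + 1 - (k + 1)
    · refine Submodule.mem_sup_left (Submodule.mem_map.mpr ⟨(hankel1 K N (k + 1) q).col ⟨s, hs⟩, ?_, ?_⟩)
      · rw [Matrix.range_mulVecLin]
        exact Submodule.subset_span ⟨_, rfl⟩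
      · rw [funLeft_castSucc_hankel1_succ_col]
    · have hs' := s.2
      refine Submodule.mem_sup_right (Submodule.mem_map.mpr ⟨(hankel1 K N (k + 1) q).col ⟨(s : ℕ) - 1, by omega⟩, ?_, ?_⟩)
      · rw [Matrix.range_mulVecLin]
        exact Submodule.subset_span ⟨_, rfl⟩
      · rw [funLeft_succ_hankel1_succ_col]
        exact congrArg _ (Fin.ext (by simp only; omega))
  · rw [Submodule.map_le_iff_le_comap, Matrix.range_mulVecLin, Submodule.span_le]
    rintro _ ⟨s', rfl⟩
    rw [SetLike.mem_coe, Submodule.mem_comap, funLeft_castSucc_hankel1_succ_col, Matrix.range_mulVecLin]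
    exact Submodule.subset_span ⟨_, rfl⟩
  · rw [Submodule.map_le_iff_le_comap, Matrix.range_mulVecLin, Submodule.span_le]
    rintro _ ⟨s', rfl⟩
    rw [SetLike.mem_coe, Submodule.mem_comap, funLeft_succ_hankel1_succ_col, Matrix.range_mulVecLin]
    exact Submodule.subset_span ⟨_, rfl⟩

/-- **`col H_{k+1}(q) ⊆ col H_{k+1}(q′) ⇒ col H_k(q) ⊆ col H_k(q′)`** (`k + 1 ≤ N`): the higher column space controls the lower. -/
theorem range_hankel1_mono_of_succ {k : ℕ} (hk : k + 1 ≤ N) {q q' : ℕ → K}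
    (h : LinearMap.range (hankel1 K N (k + 1) q).mulVecLin ≤ LinearMap.range (hankel1 K N (k + 1) q').mulVecLin) :
    LinearMap.range (hankel1 K N k q).mulVecLin ≤ LinearMap.range (hankel1 K N k q').mulVecLin := by
  rw [range_hankel1_eq_map_sup_map K hk q, range_hankel1_eq_map_sup_map K hk q']
  exact sup_le_sup (Submodule.map_mono h) (Submodule.map_mono h)

/-- `col H_{k+1}(q) = col H_{k+1}(q′) ⇒ col H_k(q) = col H_k(q′)` (`k + 1 ≤ N`). -/
theorem range_hankel1_eq_of_succ {k : ℕ} (hk : k + 1 ≤ N) {q q' : ℕ → K}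
    (h : LinearMap.range (hankel1 K N (k + 1) q).mulVecLin = LinearMap.range (hankel1 K N (k + 1) q').mulVecLin) :
    LinearMap.range (hankel1 K N k q).mulVecLin = LinearMap.range (hankel1 K N k q').mulVecLin := by
  rw [range_hankel1_eq_map_sup_map K hk q, range_hankel1_eq_map_sup_map K hk q', h]

/-- **DOWN ALL THE DEGREES: `col H_k(q) ⊆ col H_k(q′) ⇒ col H_{k′}(q) ⊆ col H_{k′}(q′)` for every `k′ ≤ k ≤ N`.** -/
theorem range_hankel1_mono_of_le {k k' : ℕ} (hk'k : k' ≤ k) (hk : k ≤ N) {q q' : ℕ → K}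
    (h : LinearMap.range (hankel1 K N k q).mulVecLin ≤ LinearMap.range (hankel1 K N k q').mulVecLin) :
    LinearMap.range (hankel1 K N k' q).mulVecLin ≤ LinearMap.range (hankel1 K N k' q').mulVecLin := by
  obtain ⟨d, rfl⟩ := Nat.exists_eq_add_of_le hk'k
  induction d with
  | zero => simpa only [Nat.add_zero] using h
  | succ d ih =>
    exact ih (by omega) (by omega) (range_hankel1_mono_of_succ K (by omega) (by rwa [show k' + (d + 1) = k' + d + 1 by omega] at h))

/-- `col H_k(q) = col H_k(q′) ⇒ col H_{k′}(q) = col H_{k′}(q′)` for every `k′ ≤ k ≤ N`. -/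
theorem range_hankel1_eq_of_le {k k' : ℕ} (hk'k : k' ≤ k) (hk : k ≤ N) {q q' : ℕ → K}
    (h : LinearMap.range (hankel1 K N k q).mulVecLin = LinearMap.range (hankel1 K N k q').mulVecLin) :
    LinearMap.range (hankel1 K N k' q).mulVecLin = LinearMap.range (hankel1 K N k' q').mulVecLin :=
  le_antisymm (range_hankel1_mono_of_le K hk'k hk h.le) (range_hankel1_mono_of_le K hk'k hk h.ge)

end Summit.Ventures.HSemireg.Wedge.HankelOuter
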